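import Summits.ResolutionOfSingularities.ResolutionOfSingularities.Theorems.CurveBranchRoot45
import Summits.ResolutionOfSingularities.ResolutionOfSingularities.Theorems.SurfaceShadowKernels
import HarnessLib

/-!
# Submaximal shadow cut — CLASSES (lens-4 g46, node «SubmaximalCut», slice S1)

Door (S) of ROW 248: the binder `hSL : MaxContactCut.SurfaceLawAll` of the g45 root `noForcedTowers_of_g45`.

* §1 LETTERS: the SUBMAXIMAL regular-surface-hugging letter (`SubmaximalSurfaceHugging`: the hugged regular surface
  germ `𝔭 ∋ pt m` carries the marked ideal in `𝔭^(n-1)`), its complement inside `RegularSurfaceHugging`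
  (`DeepSurfaceHugging`), the located residual `DeepSurfaceLaw n` / `DeepSurfaceLawAll`, and the LEVEL SHADOW
  `levelShadow 𝔭 I ℓ = sInf {𝔞 | 𝔭 ≤ 𝔞 ∧ I ≤ 𝔞 * 𝔭 ^ ℓ}` (the «content of `I` along `𝔭` at level `ℓ`»).
* §2 DOMINANCE (Finding A): a hugged germ with regular two-dimensional quotient has order ONE at the hugging point,
  so `RegularSurfaceHugging T → ContactHugging T`; hence `SurfaceLaw n ⟸ ContactHuggingTowersTerminate n` and
  `MaxContactCut.SurfaceLawAll ⟸ MaxContactCut.NoContactHuggingTowers` (binder `hSL` is implied by binder `h71`).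
* §3 PURE-LOGIC CALCULUS: `SurfaceLaw n ↔ RegularSurfaceHuggingTowersTerminate n` (the certificate of `SurfaceLaw` is
  self-contradictory, `SurfaceShadowKernels.noCornerDescent`) and the cell split
  `RegularSurfaceHuggingTowersTerminate n ↔ NoTower n SubmaximalSurfaceHugging ∧ DeepSurfaceLaw n`.

All `k`, all `p`, every dimension; no fact / port / Leaf binders; sorry-free.
-/

set_option linter.dupNamespace false

open CategoryTheory CategoryTheory.Limits AlgebraicGeometry TopologicalSpace IsLocalRing
open Literature.AlgebraicGeometry.Resolution Scheme.IdealSheafData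
open Summit.ResolutionOfSingularities.ResolutionOfSingularities.Theorems
open ForcedTowerClasses DivergentTowerClasses MonomialTowerClasses
open HugDimensionClasses SurfaceShadowClasses SurfaceShadowKernels AbsoluteContactClasses
open Summit.ResolutionOfSingularities.ResolutionOfSingularities.Theses

universe u

namespace Summit.ResolutionOfSingularities.ResolutionOfSingularities.Theorems.HugValuationCut

/-! ## §1 Letters -/

/-- **SUBMAXIMAL regular-surface hugging** (NEW letter, g46): a regular two-dimensional germ `V(H) ∋ pt m` is hugged for
ever AND the marked ideal lies in the `(mult - 1)`-st power of the germ's ideal at the hugging point («contact order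
`n - 1` along the surface», the extremal case of the g11 surface leaf). -/
def SubmaximalSurfaceHugging (T : ForcedTower) : Prop :=
  ∃ (m : ℕ) (H : (T.St m).IdealSheafData), HugsGerm T m H ∧
    ringKrullDim ((T.St m).presheaf.stalk (T.pt m) ⧸ stalkIdeal H (T.pt m)) = (2 : WithBot ℕ∞) ∧
      IsRegularLocalRing ((T.St m).presheaf.stalk (T.pt m) ⧸ stalkIdeal H (T.pt m)) ∧
        stalkIdeal (T.D m).ideal (T.pt m) ≤ stalkIdeal H (T.pt m) ^ ((T.D m).mult - 1)

/-- **DEEP regular-surface hugging** (the located residual letter, g46): some regular surface germ is hugged for ever,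
but NO hugged regular surface germ carries the marked ideal in its `(mult - 1)`-st power (contact order `≤ n - 2` along
every hugged regular surface germ). -/
def DeepSurfaceHugging (T : ForcedTower) : Prop :=
  RegularSurfaceHugging T ∧ ¬ SubmaximalSurfaceHugging T

/-- **THE LOCATED RESIDUAL of door (S) after g46 · UNDECIDED**: no infinite forced tower of weight `n` hugs a regular
surface germ DEEPLY (paper proof: the closure-normalised shadow SL-a…SL-f of `SurfaceShadowClasses`). -/
def DeepSurfaceLaw (n : ℕ) : Prop := NoTower n DeepSurfaceHugging

/-- `DeepSurfaceLaw n` for every weight `n ≥ 1` (the shape of the root binder replacing `MaxContactCut.SurfaceLawAll`). -/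
def DeepSurfaceLawAll : Prop := ∀ n : ℕ, 1 ≤ n → DeepSurfaceLaw n

/-- **DEEP contact hugging** (the located residual letter of the CONTACT column `h71` after g46): permanent contact with a
regular hypersurface germ, but NO hugged regular surface germ carries the marked ideal in its `(mult - 1)`-st power — the
exact complement of `SubmaximalSurfaceHugging` inside `ContactHugging`. -/
def DeepContactHugging (T : ForcedTower) : Prop :=
  ContactHugging T ∧ ¬ SubmaximalSurfaceHugging T

/-- **THE LOCATED RESIDUAL of the contact column after g46 · UNDECIDED**: no infinite forced tower of weight `n` has deep
permanent contact. -/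
def DeepContactLaw (n : ℕ) : Prop := NoTower n DeepContactHugging

/-- `DeepContactLaw n` for every weight `n ≥ 1` (the exact carve of `MaxContactCut.NoContactHuggingTowers`, see
`noContactHuggingTowers_iff_g46`). -/
def DeepContactLawAll : Prop := ∀ n : ℕ, 1 ≤ n → DeepContactLaw n

/-- **The LEVEL-`ℓ` SHADOW of `I` along `𝔭`**: the least ideal `𝔞 ⊇ 𝔭` with `I ⊆ 𝔞·𝔭^ℓ` (for `I ⊆ 𝔭^ℓ` and `𝔭`
generated by a quasi-regular sequence it is `𝔭 +` the ideal of coefficients of the degree-`ℓ` forms representing the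
members of `I`; its image in `R/𝔭` is the «content of `I` at level `ℓ`»). -/
noncomputable def levelShadow {R : Type*} [CommRing R] (𝔭 I : Ideal R) (ℓ : ℕ) : Ideal R :=
  sInf {𝔞 : Ideal R | 𝔭 ≤ 𝔞 ∧ I ≤ 𝔞 * 𝔭 ^ ℓ}

/-- the shadow lies below every qualifying ideal. [folklore] -/
theorem levelShadow_le {R : Type*} [CommRing R] {𝔭 I 𝔞 : Ideal R} {ℓ : ℕ} (h𝔭 : 𝔭 ≤ 𝔞) (hI : I ≤ 𝔞 * 𝔭 ^ ℓ) :
    levelShadow 𝔭 I ℓ ≤ 𝔞 :=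
  sInf_le ⟨h𝔭, hI⟩

/-- `𝔭 ⊆` the shadow. [folklore] -/
theorem le_levelShadow {R : Type*} [CommRing R] (𝔭 I : Ideal R) (ℓ : ℕ) : 𝔭 ≤ levelShadow 𝔭 I ℓ :=
  le_sInf fun _ h => h.1

/-- the shadow of the zero-th level of anything below `⊤ * 𝔭^0` is bounded by `⊤` only: `⊤` always qualifies. [folklore] -/
theorem top_mem_levelShadow_set {R : Type*} [CommRing R] {𝔭 I : Ideal R} {ℓ : ℕ} (hI : I ≤ 𝔭 ^ ℓ) :
    (⊤ : Ideal R) ∈ {𝔞 : Ideal R | 𝔭 ≤ 𝔞 ∧ I ≤ 𝔞 * 𝔭 ^ ℓ} :=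
  ⟨le_top, by rwa [Ideal.top_mul]⟩

/-- **the SHADOW FRAME at stage `m + j`** (the induction invariant of LAW E): a part `u` of a regular system of
parameters generating the stalk of the `j`-th strict transform of the hugged germ `H`, the stalk of dimension `c + 2`,
the marked stalk inside `(u)^(n-1)`, and `𝔪^λ` inside the level-`(n-1)` shadow. -/
def ShadowFrame (T : ForcedTower) (n m : ℕ) (H : (T.St m).IdealSheafData) (j c la : ℕ) : Prop :=
  ∃ u : Fin c → (T.St (m + j)).presheaf.stalk (T.pt (m + j)),
    IsRsopPart u ∧ Ideal.span (Set.range u) = stalkIdeal (strictIter T m H j) (T.pt (m + j)) ∧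
      ringKrullDim ((T.St (m + j)).presheaf.stalk (T.pt (m + j))) = (c + 2 : ℕ) ∧
        stalkIdeal (T.D (m + j)).ideal (T.pt (m + j)) ≤ Ideal.span (Set.range u) ^ (n - 1) ∧
          maximalIdeal _ ^ la ≤
            levelShadow (Ideal.span (Set.range u)) (stalkIdeal (T.D (m + j)).ideal (T.pt (m + j))) (n - 1)

/-! ## §2 Dominance: regular-surface hugging is contact hugging -/

section Dominance

variable {k : Type} [Field k]

/-- **a hugged germ with REGULAR quotient of POSITIVE dimension drop has order one**: if `V(H) ∋ pt m` is hugged and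
`𝒪_{pt m}/H_{pt m}` is a regular local ring different from `𝒪_{pt m}` itself... precisely: `H_{pt m} ≠ ⊥` is generated by
part of a regular system of parameters, whose members lie outside `𝔪²`. [cite: Matsumura1987, Thm. 14.2] -/
theorem idealOrder_eq_one_of_isRegularLocalRing_quotient (T : ForcedTower) (g : T.St 0 ⟶ Spec (.of k))
    (hB : IsBase (T.St 0) g) {m : ℕ} {H : (T.St m).IdealSheafData} (hH : HugsGerm T m H)
    [IsRegularLocalRing ((T.St m).presheaf.stalk (T.pt m) ⧸ stalkIdeal H (T.pt m))] :
    idealOrder H (T.pt m) = 1 := by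
  haveI : IsRegularLocalRing ((T.St m).presheaf.stalk (T.pt m)) :=
    (tower_isLocallyNoetherian_isRegular T g hB m).2 (T.pt m)
  have hle : stalkIdeal H (T.pt m) ≤ maximalIdeal _ :=
    (mem_support_iff_stalkIdeal_le _ _).mp (hH.2 0)
  have hne : stalkIdeal H (T.pt m) ≠ ⊥ := fun h0 => hH.1 (idealOrder_eq_top_of_stalkIdeal_eq_bot' _ _ h0)
  obtain ⟨r, w, hw, hJ⟩ := exists_isRsopPart_of_isRegularLocalRing_quotient hle
  -- `r ≥ 1` since the ideal is non-zero
  have hr : 0 < r := by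
    rcases Nat.eq_zero_or_pos r with h | h
    · subst h
      exact absurd (by rw [hJ, Set.range_eq_empty, Ideal.span_empty]) hne
    · exact h
  refine le_antisymm ?_ ?_
  · by_contra hlt
    rw [not_le] at hlt
    have h2 : ((2 : ℕ) : ℕ∞) ≤ idealOrder H (T.pt m) := by
      have : (1 : ℕ∞) + 1 ≤ idealOrder H (T.pt m) := (ENat.add_one_le_iff (ENat.coe_ne_top 1)).mpr hlt
      exact_mod_cast this
    rw [le_idealOrder_iff, hJ] at h2
    exact hw.not_mem_sq ⟨0, hr⟩ (h2 (Ideal.subset_span ⟨⟨0, hr⟩, rfl⟩))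
  · rw [show (1 : ℕ∞) = ((1 : ℕ) : ℕ∞) from rfl, le_idealOrder_iff, pow_one]
    exact hle

/-- **DOMINANCE (Finding A of g46): a forced tower hugging a REGULAR SURFACE germ has PERMANENT CONTACT** with the same
germ (`ord_{pt m} H = 1`). [cite: Matsumura1987, Thm. 14.2] -/
theorem contactHugging_of_regularSurfaceHugging (T : ForcedTower) (g : T.St 0 ⟶ Spec (.of k))
    (hB : IsBase (T.St 0) g) (h : RegularSurfaceHugging T) : ContactHugging T := by
  obtain ⟨m, H, hH, -, hreg⟩ := h
  haveI := hreg
  exact ⟨m, H, idealOrder_eq_one_of_isRegularLocalRing_quotient T g hB hH, hH⟩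

/-- a SUBMAXIMALLY hugging tower has permanent contact. [cite: Matsumura1987, Thm. 14.2] -/
theorem contactHugging_of_submaximalSurfaceHugging (T : ForcedTower) (g : T.St 0 ⟶ Spec (.of k))
    (hB : IsBase (T.St 0) g) (h : SubmaximalSurfaceHugging T) : ContactHugging T := by
  obtain ⟨m, H, hH, hd, hreg, -⟩ := h
  exact contactHugging_of_regularSurfaceHugging T g hB ⟨m, H, hH, hd, hreg⟩

/-- **`SurfaceLaw n ⟸ ContactHuggingTowersTerminate n`** (the surface column is a sub-column of the contact column).
[folklore] -/
theorem surfaceLaw_of_contactHuggingTowersTerminate {n : ℕ} (h : ContactHuggingTowersTerminate n) : SurfaceLaw n :=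
  fun p hp k _ _ T g hB hD hE hR => (h p hp k T g hB hD hE (contactHugging_of_regularSurfaceHugging T g hB hR)).elim

/-- **binder `hSL` of the g45 root is implied by binder `h71`**: `MaxContactCut.NoContactHuggingTowers →
MaxContactCut.SurfaceLawAll`. [folklore] -/
theorem surfaceLawAll_of_noContactHuggingTowers (h : MaxContactCut.NoContactHuggingTowers) :
    MaxContactCut.SurfaceLawAll :=
  fun n hn => surfaceLaw_of_contactHuggingTowersTerminate (h n hn)

end Dominance

/-! ## §3 Pure-logic calculus of the surface column -/

/-- **`SurfaceLaw n ⟺ RegularSurfaceHuggingTowersTerminate n`** (the corner-descent certificate is self-contradictory).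
[folklore] -/
theorem surfaceLaw_iff_noTower {n : ℕ} : SurfaceLaw n ↔ RegularSurfaceHuggingTowersTerminate n := by
  refine ⟨regularSurface_of_surfaceLaw, fun h p hp k _ _ T g hB hD hE hR => ?_⟩
  exact (h p hp k T g hB hD hE hR).elim

/-- a submaximally hugged regular surface germ is a hugged regular surface germ. [folklore] -/
theorem regularSurfaceHugging_of_submaximal {T : ForcedTower} (h : SubmaximalSurfaceHugging T) :
    RegularSurfaceHugging T := by
  obtain ⟨m, H, hH, hd, hreg, -⟩ := h
  exact ⟨m, H, hH, hd, hreg⟩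

/-- **EXACT cell split of the surface column**: `NoTower n RegularSurfaceHugging ⟺ (submaximal cell) ∧ (deep cell)`.
[folklore] -/
theorem regularSurfaceHuggingTowersTerminate_iff_cells {n : ℕ} :
    RegularSurfaceHuggingTowersTerminate n ↔ NoTower n SubmaximalSurfaceHugging ∧ DeepSurfaceLaw n := by
  refine ⟨fun h => ⟨fun p hp k _ _ T g hB hD hE hS => h p hp k T g hB hD hE (regularSurfaceHugging_of_submaximal hS),
    fun p hp k _ _ T g hB hD hE hS => h p hp k T g hB hD hE hS.1⟩, fun ⟨h₁, h₂⟩ p hp k _ _ T g hB hD hE hR => ?_⟩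
  by_cases hS : SubmaximalSurfaceHugging T
  · exact h₁ p hp k T g hB hD hE hS
  · exact h₂ p hp k T g hB hD hE ⟨hR, hS⟩

/-- **EXACT cell split of the contact column**: `NoTower n ContactHugging ⟺ (submaximal cell) ∧ (deep contact cell)`.
[folklore] -/
theorem contactHuggingTowersTerminate_iff_cells {n : ℕ} :
    ContactHuggingTowersTerminate n ↔ NoTower n SubmaximalSurfaceHugging ∧ DeepContactLaw n := by
  refine ⟨fun h => ⟨fun p hp k _ _ T g hB hD hE hS => h p hp k T g hB hD hE
    (contactHugging_of_submaximalSurfaceHugging T g hB hS), fun p hp k _ _ T g hB hD hE hS => h p hp k T g hB hD hE hS.1⟩,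
    fun ⟨h₁, h₂⟩ p hp k _ _ T g hB hD hE hC => ?_⟩
  by_cases hS : SubmaximalSurfaceHugging T
  · exact h₁ p hp k T g hB hD hE hS
  · exact h₂ p hp k T g hB hD hE ⟨hC, hS⟩

/-- **the DEEP residual is implied by the contact column** (for the 12-binder root reading). [folklore] -/
theorem deepSurfaceLawAll_of_noContactHuggingTowers (h : MaxContactCut.NoContactHuggingTowers) :
    DeepSurfaceLawAll := fun n hn =>
  (regularSurfaceHuggingTowersTerminate_iff_cells.mp (surfaceLaw_iff_noTower.mp
    (surfaceLawAll_of_noContactHuggingTowers h n hn))).2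

end Summit.ResolutionOfSingularities.ResolutionOfSingularities.Theorems.HugValuationCut
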